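import Literature.NumberTheory.Sieve.MaynardCollatzWielandt
import Literature.NumberTheory.Sieve.MaynardTaoL2Reduction
import HarnessLib

/-!
# The Rayleigh-quotient form of the Maynard functional, `∑_m J^{(m)}(F) = ⟨ℒF, F⟩`, and the
# Collatz–Wielandt LOWER bound `ℒG ≥ λG ⇒ M_k ≥ λ`

Topic `Literature/NumberTheory/Sieve`; companion of `MaynardCollatzWielandt.lean` (the operator
`ℒ = ∑_m P_m` of Polymath 8b §7.1, `MaynardCW.maynardOperator`, and the UPPER bound
`maynardFunctional_le_of_subsolution`).  Source: D. H. J. Polymath, *Variants of the Selberg sieve, and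
bounded intervals containing many primes*, Res. Math. Sci. 1:12 (2014) = arXiv:1407.4897v4: §7.1, p. 30
("This is a self-adjoint and positive semi-definite operator on `L²(R_k)`.  For symmetric `b_1,…,b_n` …
`M_2 = (⟨ℒ b_i, b_j⟩)`", i.e. the numerator quadratic form `∑_i J_i` of (7.3) is the form of `ℒ`), and
the first half of the proof of Corollary 6.2, p. 24 (`λ I(F) = ∫ λF·F = ∑_i ∫ (∫ F dt_i) F = ∑_i J_i(F)`,
spelled out in Broughan, *Bounded Gaps Between Primes* (CUP 2021), proof of Corollary 7.9).

* `MaynardCW.maynardJ_eq_integral_fibreIntegral_mul` — `J^{(m)}(F) = ∫ (P_m F)·F` for `F` measurable,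
  bounded and supported on `R_{n+1}`.
* `sum_maynardJ_eq_integral_maynardOperator_mul` — `∑_m J^{(m)}(F) = ∫ (ℒF)·F`, and
  `maynardFunctional_eq_rayleigh` — `(∑_m J^{(m)}(F))/I(F) = (∫ (ℒF)·F)/(∫_{R_k} F²)`.
* `le_maynardFunctional_of_supersolution` — **Collatz–Wielandt lower bound**: if moreover `F ≥ 0` on
  `R_{n+1}`, `I(F) > 0` and `(ℒF)(t) ≥ λ F(t)` on `R_{n+1}`, then `λ ≤ (∑_m J^{(m)}(F))/I(F)` (`≤ M_k`).  With
  `maynardFunctional_le_of_subsolution` this is the two-sided inclusion `λ₁ ≤ M_k ≤ λ₂` from a single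
  positive test function with `λ₁ F ≤ ℒF ≤ λ₂ F` (Corollary 6.2 is the case `λ₁ = λ₂`).

No new named facts.  The coordinate `t_m` is split off with the volume-preserving
`MeasurableEquiv.piFinSuccAbove` and Fubini, as in `MaynardTao.maynardJ_le`; the fibre value of `P_m F` is
`MaynardCW.fibreIntegral_insertNth`, and `J^{(m)}` is rewritten through the tree's
`MaynardL2.maynardJ_eq_integral_fibreAvg`.

## References
* [Polymath8b2014] D. H. J. Polymath, *op. cit.*, §7.1 (p. 30: `ℒ`, self-adjointness, `M_2 = (⟨ℒb_i,b_j⟩)`)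
  and the proof of Corollary 6.2 (p. 24).
* K. Broughan, *Bounded Gaps Between Primes* (Cambridge Univ. Press, 2021), proof of Corollary 7.9.
-/

noncomputable section

open MeasureTheory Set Filter Finset
open scoped ENNReal BigOperators

namespace Literature.NumberTheory.Sieve

namespace MaynardCW

variable {n : ℕ}

/-- On a fibre over an outer point `s`: if `F` vanishes off `R_{n+1}` then the whole-line section
integral, the interval average `∫₀¹`, and the fibre integral `∫_{(0,1-∑s]}` of `u ↦ F(insertNth m u s)` all
coincide. [folklore] -/
private theorem section_integrals_eq (m : Fin (n + 1)) {F : (Fin (n + 1) → ℝ) → ℝ}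
    (hF : ∀ t, t ∉ maynardSimplex (n + 1) → F t = 0) (s : Fin n → ℝ) :
    (∫ u, F (Fin.insertNth m u s)) = ∫ u in Ioc (0:ℝ) (1 - ∑ j, s j), F (Fin.insertNth m u s) ∧
    (∫ u in (0:ℝ)..1, F (Fin.insertNth m u s)) = ∫ u in Ioc (0:ℝ) (1 - ∑ j, s j), F (Fin.insertNth m u s) := by
  have hzero : ∀ u, ¬ ((0 ≤ u ∧ ∀ j, 0 ≤ s j) ∧ u + ∑ j, s j ≤ 1) → F (Fin.insertNth m u s) = 0 :=
    fun u hu => hF _ fun h => hu ((MaynardLargeK.insertNth_mem_maynardSimplex_iff m u s).1 h)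
  by_cases hs : (∀ j, 0 ≤ s j) ∧ ∑ j, s j ≤ 1
  · -- whole line → Icc 0 L → Ioc 0 L ;  Ioc 0 1 → Ioc 0 L
    have hIcc : (∫ u, F (Fin.insertNth m u s)) = ∫ u in Icc (0:ℝ) (1 - ∑ j, s j), F (Fin.insertNth m u s) := by
      refine (setIntegral_eq_integral_of_forall_compl_eq_zero fun u hu => hzero u fun h => hu ?_).symm
      exact ⟨h.1.1, by linarith [h.2]⟩
    have h1 : (∫ u, F (Fin.insertNth m u s)) = ∫ u in Ioc (0:ℝ) (1 - ∑ j, s j), F (Fin.insertNth m u s) := by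
      rw [hIcc, integral_Icc_eq_integral_Ioc]
    refine ⟨h1, ?_⟩
    rw [intervalIntegral.integral_of_le zero_le_one]
    have hsub : Ioc (0:ℝ) (1 - ∑ j, s j) ⊆ Ioc (0:ℝ) 1 := Ioc_subset_Ioc_right (by
      have : 0 ≤ ∑ j, s j := Finset.sum_nonneg fun j _ => hs.1 j
      linarith)
    exact setIntegral_eq_of_subset_of_forall_sdiff_eq_zero measurableSet_Ioc hsub fun u hu =>
      hzero u fun h => hu.2 ⟨hu.1.1, by linarith [h.2]⟩
  · have hz : ∀ u, F (Fin.insertNth m u s) = 0 := fun u =>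
      hzero u fun h => hs ⟨h.1.2, by linarith [h.2, h.1.1]⟩
    simp [hz]

/-- For `F` vanishing off `R_{n+1}` and bounded by `B` there, `|P_m F| ≤ B` along every fibre:
`|fibreIntegral m F (insertNth m u s)| ≤ B` for every `u, s`. [folklore] -/
private theorem abs_fibreIntegral_insertNth_le (m : Fin (n + 1)) {F : (Fin (n + 1) → ℝ) → ℝ}
    (hF : ∀ t, t ∉ maynardSimplex (n + 1) → F t = 0) {B : ℝ} (hB0 : 0 ≤ B)
    (hB : ∀ t ∈ maynardSimplex (n + 1), |F t| ≤ B) (u : ℝ) (s : Fin n → ℝ) :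
    |fibreIntegral m F (Fin.insertNth m u s)| ≤ B := by
  rw [fibreIntegral_insertNth]
  have hpt : ∀ v, |F (Fin.insertNth m v s)| ≤ B := fun v => by
    by_cases hv : Fin.insertNth m v s ∈ maynardSimplex (n + 1)
    · exact hB _ hv
    · rw [hF _ hv, abs_zero]; exact hB0
  by_cases hs : ∀ j, 0 ≤ s j
  · have hsum : 0 ≤ ∑ j, s j := Finset.sum_nonneg fun j _ => hs j
    by_cases hL : 0 ≤ 1 - ∑ j, s j
    · have hvol : volume (Ioc (0:ℝ) (1 - ∑ j, s j)) < ⊤ := by simp [Real.volume_Ioc]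
      calc |∫ v in Ioc (0:ℝ) (1 - ∑ j, s j), F (Fin.insertNth m v s)|
          ≤ B * (volume : Measure ℝ).real (Ioc (0:ℝ) (1 - ∑ j, s j)) := by
            rw [← Real.norm_eq_abs]
            exact norm_setIntegral_le_of_norm_le_const hvol fun v _ => by
              rw [Real.norm_eq_abs]; exact hpt v
        _ ≤ B * 1 := by
            refine mul_le_mul_of_nonneg_left ?_ hB0
            rw [Measure.real, Real.volume_Ioc, sub_zero, ENNReal.toReal_ofReal hL]
            linarith
        _ = B := mul_one B
    · rw [Ioc_eq_empty (fun h => hL (le_of_lt h)), Measure.restrict_empty, integral_zero_measure,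
        abs_zero]
      exact hB0
  · -- some `s_j < 0`: the fibre misses `R_{n+1}` and the section vanishes
    have hz : ∀ v, F (Fin.insertNth m v s) = 0 := fun v => hF _ fun h =>
      hs ((MaynardLargeK.insertNth_mem_maynardSimplex_iff m v s).1 h).1.2
    simp [hz, hB0]

/-- `F` measurable, bounded and vanishing off `R_{n+1}` is integrable. [folklore] -/
private theorem integrable_of_bounded_support {F : (Fin (n + 1) → ℝ) → ℝ} (hFm : Measurable F)
    (hF : ∀ t, t ∉ maynardSimplex (n + 1) → F t = 0) {B : ℝ}
    (hB : ∀ t ∈ maynardSimplex (n + 1), |F t| ≤ B) : Integrable F := by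
  refine IntegrableOn.integrable_of_forall_notMem_eq_zero (s := maynardSimplex (n + 1)) ?_ hF
  refine IntegrableOn.of_bound (isCompact_maynardSimplex (n + 1)).measure_lt_top
    hFm.aestronglyMeasurable B ?_
  rw [ae_restrict_iff' (measurableSet_maynardSimplex (n + 1))]
  exact ae_of_all _ fun t ht => by rw [Real.norm_eq_abs]; exact hB t ht

/-- **`J^{(m)}(F) = ⟨P_m F, F⟩`**: for `F` measurable, bounded and supported on `R_{n+1}`,
`J^{(m)}_{n+1}(F) = ∫ (P_m F)(t) F(t) dt` with `(P_m F)(t) = ∫₀^{1-∑_{j≠m}t_j} F(t with t_m := u) du` — one summand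
of "`M_2 = (⟨ℒ b_i, b_j⟩)`" (Polymath 8b §7.1) / of `λI(F) = ∑_i ∫(∫F dt_i)F = ∑_i J_i(F)` (proof of
Corollary 6.2). [cite: Polymath8b2014, §7.1 (M_2 = (⟨L b_i, b_j⟩), p. 30) and proof of Corollary 6.2] -/
theorem maynardJ_eq_integral_fibreIntegral_mul (m : Fin (n + 1)) {F : (Fin (n + 1) → ℝ) → ℝ}
    (hFm : Measurable F) (hF : ∀ t, t ∉ maynardSimplex (n + 1) → F t = 0) {B : ℝ}
    (hB : ∀ t ∈ maynardSimplex (n + 1), |F t| ≤ B) :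
    maynardJ (n + 1) m F = ∫ t, fibreIntegral m F t * F t := by
  have hB0 : 0 ≤ B := by
    have h0 : (fun _ => (0:ℝ)) ∈ maynardSimplex (n + 1) := ⟨fun _ => le_rfl, by simp⟩
    exact (abs_nonneg _).trans (hB _ h0)
  -- the fibre value `C s = ∫_{(0,1-∑s]} F(insertNth m v s) dv`
  set C : (Fin n → ℝ) → ℝ := fun s => ∫ v in Ioc (0:ℝ) (1 - ∑ j, s j), F (Fin.insertNth m v s) with hC
  -- LHS through the fibre average
  have hsupp : Function.support F ⊆ maynardSimplex (n + 1) := fun t ht => by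
    by_contra h; exact ht (hF t h)
  have hL : maynardJ (n + 1) m F = ∫ s in maynardCube n, C s ^ 2 := by
    rw [MaynardL2.maynardJ_eq_integral_fibreAvg, Set.indicator_eq_self.2 hsupp]
    refine integral_congr_ae (ae_of_all _ fun s => ?_)
    dsimp only
    rw [MaynardL2.fibreAvg_def, (section_integrals_eq m hF s).2]
  -- `C` vanishes off the cube `[0,1]^n`
  have hCzero : ∀ s, s ∉ maynardCube n → C s ^ 2 = 0 := by
    intro s hs
    have hz : ∀ v, F (Fin.insertNth m v s) = 0 := by
      intro v
      refine hF _ fun h => hs ?_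
      have h' := (MaynardLargeK.insertNth_mem_maynardSimplex_iff m v s).1 h
      intro j _
      refine ⟨h'.1.2 j, ?_⟩
      calc s j ≤ ∑ i, s i := Finset.single_le_sum (fun i _ => h'.1.2 i) (Finset.mem_univ j)
        _ ≤ 1 := by linarith [h'.2, h'.1.1]
    simp [hC, hz]
  have hL' : maynardJ (n + 1) m F = ∫ s, C s ^ 2 := by
    rw [hL]; exact setIntegral_eq_integral_of_forall_compl_eq_zero hCzero
  -- RHS: Fubini along the `m`-th coordinate
  set g : (Fin (n + 1) → ℝ) → ℝ := fun t => fibreIntegral m F t * F t with hg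
  have hFint : Integrable F := integrable_of_bounded_support hFm hF hB
  have hPbdd : ∀ t, |fibreIntegral m F t| ≤ B := fun t => by
    rw [← Fin.insertNth_self_removeNth m t]; exact abs_fibreIntegral_insertNth_le m hF hB0 hB _ _
  have hgint : Integrable g :=
    hFint.bdd_mul (measurable_fibreIntegral m hFm).aestronglyMeasurable
      (ae_of_all _ fun t => by rw [Real.norm_eq_abs]; exact hPbdd t)
  set e := MeasurableEquiv.piFinSuccAbove (fun _ : Fin (n + 1) => ℝ) m with he_def
  have he : MeasurePreserving e.symm ((volume : Measure ℝ).prod volume) volume := by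
    have h := (volume_preserving_piFinSuccAbove (fun _ : Fin (n + 1) => ℝ) m).symm
    rwa [Measure.volume_eq_prod] at h
  have he_apply : ∀ p : ℝ × (Fin n → ℝ), e.symm p = Fin.insertNth m p.1 p.2 := fun p => by
    rw [he_def, MeasurableEquiv.piFinSuccAbove_symm_apply]; rfl
  have hR : ∫ t, g t = ∫ s, C s ^ 2 := by
    rw [← he.integral_comp e.symm.measurableEmbedding g]
    have hgi : Integrable (g ∘ e.symm) ((volume : Measure ℝ).prod volume) :=
      (he.integrable_comp_emb e.symm.measurableEmbedding).2 hgint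
    rw [show (fun x => g (e.symm x)) = g ∘ e.symm from rfl, integral_prod_symm _ hgi]
    refine integral_congr_ae (ae_of_all _ fun s => ?_)
    dsimp only [Function.comp]
    simp_rw [he_apply]
    show ∫ u, fibreIntegral m F (Fin.insertNth m u s) * F (Fin.insertNth m u s) = C s ^ 2
    simp_rw [fibreIntegral_insertNth]
    rw [integral_const_mul, (section_integrals_eq m hF s).1]
    simp only [hC, sq]
  rw [hL', ← hR]

end MaynardCW

open MaynardCW in
/-- **The numerator of `M_k` is the quadratic form of `ℒ`**: for `F` measurable, bounded and supported on
`R_{n+1}`, `∑_m J^{(m)}(F) = ∫ (ℒF)(t) F(t) dt` (Polymath 8b §7.1: "`M_2 = (⟨ℒ b_i, b_j⟩)`"; proof of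
Corollary 6.2: `λ I(F) = ∑_i ∫ (∫ F dt_i) F = ∑_i J_i(F)`). [cite: Polymath8b2014, §7.1 (p. 30) and proof of Corollary 6.2 (p. 24)] -/
theorem sum_maynardJ_eq_integral_maynardOperator_mul {n : ℕ} {F : (Fin (n + 1) → ℝ) → ℝ}
    (hFm : Measurable F) (hF : ∀ t, t ∉ maynardSimplex (n + 1) → F t = 0) {B : ℝ}
    (hB : ∀ t ∈ maynardSimplex (n + 1), |F t| ≤ B) :
    ∑ m, maynardJ (n + 1) m F = ∫ t, maynardOperator F t * F t := by
  have hB0 : 0 ≤ B := by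
    have h0 : (fun _ => (0:ℝ)) ∈ maynardSimplex (n + 1) := ⟨fun _ => le_rfl, by simp⟩
    exact (abs_nonneg _).trans (hB _ h0)
  have hFint : Integrable F := integrable_of_bounded_support hFm hF hB
  have hint : ∀ m, Integrable fun t => fibreIntegral m F t * F t := fun m =>
    hFint.bdd_mul (measurable_fibreIntegral m hFm).aestronglyMeasurable
      (ae_of_all _ fun t => by
        rw [Real.norm_eq_abs, ← Fin.insertNth_self_removeNth m t]
        exact abs_fibreIntegral_insertNth_le m hF hB0 hB _ _)
  simp_rw [maynardJ_eq_integral_fibreIntegral_mul _ hFm hF hB]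
  rw [← integral_finsetSum _ fun m _ => hint m]
  refine integral_congr_ae (ae_of_all _ fun t => ?_)
  dsimp only
  rw [maynardOperator_def, Finset.sum_mul]

open MaynardCW in
/-- **Rayleigh-quotient form of the Maynard functional**: `(∑_m J^{(m)}(F))/I(F) = ⟨ℒF, F⟩/⟨F, F⟩` for `F`
measurable, bounded and supported on `R_{n+1}` ("`M_1 = (⟨b_i, b_j⟩)`, `M_2 = (⟨ℒ b_i, b_j⟩)`").
[cite: Polymath8b2014, §7.1 (p. 30)] -/
theorem maynardFunctional_eq_rayleigh {n : ℕ} {F : (Fin (n + 1) → ℝ) → ℝ}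
    (hFm : Measurable F) (hF : ∀ t, t ∉ maynardSimplex (n + 1) → F t = 0) {B : ℝ}
    (hB : ∀ t ∈ maynardSimplex (n + 1), |F t| ≤ B) :
    maynardFunctional (n + 1) F = (∫ t, maynardOperator F t * F t) / ∫ t, F t ^ 2 := by
  unfold maynardFunctional
  rw [sum_maynardJ_eq_integral_maynardOperator_mul hFm hF hB]
  congr 1
  refine setIntegral_eq_integral_of_forall_compl_eq_zero fun t ht => ?_
  simp [hF t ht]

open MaynardCW in
/-- **Collatz–Wielandt LOWER bound for the Maynard functional.**  Let `F ≥ 0` be measurable, bounded,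
supported on `R_{n+1}` with `I(F) > 0`, and suppose `(ℒF)(t) ≥ λ·F(t)` at every point of `R_{n+1}`.  Then
`λ ≤ (∑_m J^{(m)}(F))/I(F)` (hence `λ ≤ M_{n+1}`).  Together with `maynardFunctional_le_of_subsolution` a single
positive test function with `λ₁F ≤ ℒF ≤ λ₂F` on `R_k` gives `λ₁ ≤ M_k ≤ λ₂`; the case `λ₁ = λ₂` is Polymath's
Corollary 6.2 (`M_k = λ` for a positive eigenfunction).
[cite: Polymath8b2014, proof of Corollary 6.2 (first half: λ I(F) = ∑_i J_i(F), hence M_k ≥ λ), p. 24] -/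
theorem le_maynardFunctional_of_supersolution {n : ℕ} {lam : ℝ} {F : (Fin (n + 1) → ℝ) → ℝ}
    (hFm : Measurable F) (hF : ∀ t, t ∉ maynardSimplex (n + 1) → F t = 0) {B : ℝ}
    (hB : ∀ t ∈ maynardSimplex (n + 1), |F t| ≤ B) (hnn : ∀ t ∈ maynardSimplex (n + 1), 0 ≤ F t)
    (hI : 0 < maynardI (n + 1) F)
    (hsuper : ∀ t ∈ maynardSimplex (n + 1), lam * F t ≤ maynardOperator F t) :
    lam ≤ maynardFunctional (n + 1) F := by
  have hB0 : 0 ≤ B := by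
    have h0 : (fun _ => (0:ℝ)) ∈ maynardSimplex (n + 1) := ⟨fun _ => le_rfl, by simp⟩
    exact (abs_nonneg _).trans (hB _ h0)
  have hFint : Integrable F := integrable_of_bounded_support hFm hF hB
  have hIeq : maynardI (n + 1) F = ∫ t, F t ^ 2 := by
    refine setIntegral_eq_integral_of_forall_compl_eq_zero fun t ht => ?_
    simp [hF t ht]
  have hsq : Integrable fun t => F t ^ 2 := by
    have := hFint.bdd_mul hFm.aestronglyMeasurable (ae_of_all _ fun t => show ‖F t‖ ≤ B from by
      rw [Real.norm_eq_abs]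
      by_cases ht : t ∈ maynardSimplex (n + 1)
      · exact hB t ht
      · rw [hF t ht, abs_zero]; exact hB0)
    simpa [sq] using this
  have hLF : Integrable fun t => maynardOperator F t * F t := by
    refine hFint.bdd_mul (measurable_maynardOperator hFm).aestronglyMeasurable (c := (n + 1) * B)
      (ae_of_all _ fun t => ?_)
    rw [Real.norm_eq_abs, maynardOperator_def]
    refine (Finset.abs_sum_le_sum_abs _ _).trans ?_
    calc ∑ m, |fibreIntegral m F t| ≤ ∑ _m : Fin (n + 1), B := Finset.sum_le_sum fun m _ => by
            rw [← Fin.insertNth_self_removeNth m t]; exact abs_fibreIntegral_insertNth_le m hF hB0 hB _ _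
      _ = (n + 1) * B := by simp
  rw [maynardFunctional_eq_rayleigh hFm hF hB, le_div_iff₀ (by rwa [← hIeq]), ← integral_const_mul]
  refine integral_mono_ae (hsq.const_mul lam) hLF (ae_of_all _ fun t => ?_)
  dsimp only
  by_cases ht : t ∈ maynardSimplex (n + 1)
  · have := mul_le_mul_of_nonneg_right (hsuper t ht) (hnn t ht)
    nlinarith [this]
  · simp [hF t ht]


open MaynardCW in
/-- A positive, bounded, measurable function supported on `R_{n+1}` with `I > 0` is an admissible test
function. [folklore] -/
private theorem isMaynardAdmissible_of_bounded {n : ℕ} {G : (Fin (n + 1) → ℝ) → ℝ}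
    (hGm : Measurable G) (hG : ∀ t, t ∉ maynardSimplex (n + 1) → G t = 0) {B : ℝ}
    (hB : ∀ t ∈ maynardSimplex (n + 1), |G t| ≤ B) (hI : 0 < maynardI (n + 1) G) :
    IsMaynardAdmissible (n + 1) G where
  measurable := hGm
  support_subset := fun t ht => by by_contra h; exact ht (hG t h)
  integrableOn_sq := by
    refine IntegrableOn.of_bound (isCompact_maynardSimplex (n + 1)).measure_lt_top
      (hGm.pow_const 2).aestronglyMeasurable (B ^ 2) ?_
    rw [ae_restrict_iff' (measurableSet_maynardSimplex (n + 1))]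
    refine ae_of_all _ fun t ht => ?_
    rw [Real.norm_eq_abs, abs_pow]
    exact pow_le_pow_left₀ (abs_nonneg _) (hB t ht) 2
  maynardI_pos := hI

open MaynardCW in
/-- **Polymath 8b Corollary 6.2 (a positive eigenfunction computes `M_k`), both halves.**  Let `G` be
measurable, bounded, supported on `R_{n+1}`, strictly positive on `R_{n+1}` with `I(G) > 0`, and an
eigenfunction of `ℒ` on the simplex: `(ℒG)(t) = λ·G(t)` for every `t ∈ R_{n+1}`.  Then every admissible `F` has
`(∑_m J^{(m)}(F))/I(F) ≤ λ` and `G` itself attains `λ`; i.e. `M_{n+1} = λ` ("As a corollary, we can compute `M_k`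
exactly if we can locate a positive eigenfunction" — used in print for `k = 2`, Corollary 6.3, `M_2 = 1/(1-W(1/e))`).
[cite: Polymath8b2014, Corollary 6.2 (p. 24)] -/
theorem maynardFunctional_eq_of_eigenfunction {n : ℕ} {lam : ℝ} {G : (Fin (n + 1) → ℝ) → ℝ}
    (hGm : Measurable G) (hG : ∀ t, t ∉ maynardSimplex (n + 1) → G t = 0) {B : ℝ}
    (hB : ∀ t ∈ maynardSimplex (n + 1), |G t| ≤ B) (hGpos : ∀ t ∈ maynardSimplex (n + 1), 0 < G t)
    (hI : 0 < maynardI (n + 1) G)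
    (heig : ∀ t ∈ maynardSimplex (n + 1), maynardOperator G t = lam * G t) :
    (∀ F, IsMaynardAdmissible (n + 1) F → maynardFunctional (n + 1) F ≤ lam) ∧
      maynardFunctional (n + 1) G = lam := by
  have hup : ∀ F, IsMaynardAdmissible (n + 1) F → maynardFunctional (n + 1) F ≤ lam :=
    fun F hF => maynardFunctional_le_of_subsolution hGm hB hGpos (fun t ht => (heig t ht).le) hF
  refine ⟨hup, le_antisymm (hup G (isMaynardAdmissible_of_bounded hGm hG hB hI)) ?_⟩
  exact le_maynardFunctional_of_supersolution hGm hG hB (fun t ht => (hGpos t ht).le) hI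
    fun t ht => (heig t ht).ge

end Literature.NumberTheory.Sieve
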